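import Summits.HubbardSuperconductivity.HubbardSuperconductivity.Theorems.BcsKacWindowCoherenceWindowLROEnergeticTransfer
import Summits.HubbardSuperconductivity.HubbardSuperconductivity.Theorems.CoherenceWindowLRO.Negative.LoadBearing

/-!
# Crux `CoherenceWindowLRO` — the condensation-energy export is load-bearing on the interaction

Negative-side helper for the crux item `stmt-HubbardSuperconductivity-1319` (`CoherenceWindowLRO`, route
`BcsKacWindow`), line `birth`, lead c18. The energetic transfer
`coherenceWindowLRO_of_condensationEnergy` (file `BcsKacWindowCoherenceWindowLROEnergeticTransfer`) derives
the crux from the condensation-energy comparison (CE) on the window tori,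
`minEnergyOn (H_U + (g/L²)Δ_d†Δ_d) K ≥ minEnergyOn H_U K + g·c₀Δ(U)²L²`. Here the first costume test of that
hypothesis: its free-torus analogue (`hubbardTorus 2 L 1 U ↦ hubbardTorus 2 L 1 0` in both energies, everything
else — pins, window, sector — kept) is FALSE. Proof: the same three-line variational argument turns the free
analogue of (CE) into the free analogue of the crux, which is `false_without_interaction`
(`Theorems/CoherenceWindowLRO/Negative/LoadBearing`, lead c14: the paired Fermi sea is a normalised free sector
ground state with only the `32·L²` pair background). So any proof of (CE) must use `U > 0`, exactly like the crux.

* `condensationEnergy_false_without_interaction` — the statement above (registered stub of the crux item).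

Folklore finite-dimensional linear algebra on top of the two cited tree theorems; no definition and no named fact
is introduced.
-/

set_option linter.dupNamespace false

namespace Summit.HubbardSuperconductivity.HubbardSuperconductivity.Theorems.CoherenceWindowLRO.Negative

open Matrix Literature.MathematicalPhysics.QuantumLattice
open Summit.HubbardSuperconductivity.HubbardSuperconductivity.Theorems.BcsKacWindow

/-- **The condensation-energy comparison is load-bearing on the interaction.** The free-torus analogue of
the hypothesis of `coherenceWindowLRO_of_condensationEnergy` — doping window, flat-in-`U` pins, `c₀, s₀, g > 0`,
and on every window torus `minEnergyOn (H₀ + (g/L²)Δ_d†Δ_d) K ≥ minEnergyOn H₀ K + g·c₀Δ(U)²L²` with the FREE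
Hamiltonian `H₀ = hubbardTorus 2 L 1 0` — is false: by the variational principle at a unit free sector ground
state it would give the free analogue of `CoherenceWindowLRO`, refuted by `false_without_interaction` (the paired
Fermi sea carries only the `32·L²` background, beaten at the window top). [folklore] -/
theorem condensationEnergy_false_without_interaction :
    ¬ ∃ (a b κ₁ κ₂ c₀ s₀ g : ℝ) (Δ : ℝ → ℝ), 0 < a ∧ a < b ∧ b < 1 / 2 ∧ 0 < κ₁ ∧ κ₁ ≤ κ₂ ∧
      0 < c₀ ∧ 0 < s₀ ∧ 0 < g ∧
      (∀ U : ℝ, 0 < U → Real.exp (-(κ₂ / U ^ 2)) ≤ Δ U ∧ Δ U ≤ Real.exp (-(κ₁ / U ^ 2))) ∧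
      ∀ s : ℝ, s₀ ≤ s → ∃ U₁ : ℝ, 0 < U₁ ∧ ∀ δ ∈ Set.Icc a b, ∀ U ∈ Set.Ioo (0 : ℝ) U₁,
        ∀ (L : ℕ) [NeZero L], Even L → s₀ ≤ Δ U * L → Δ U * L ≤ s →
          (hubbardTorus 2 L 1 0).minEnergyOn
              (szSector (Λ := FermionTorus 2 L) (2 * ⌊(1 - δ) * (L : ℝ) ^ 2 / 2⌋₊) 0) +
            g * c₀ * Δ U ^ 2 * (L : ℝ) ^ 2 ≤
          (hubbardTorus 2 L 1 0 +
              ((g / (L : ℝ) ^ 2 : ℝ) : ℂ) • ((pairField dWaveFormFactor L)ᴴ * pairField dWaveFormFactor L)).minEnergyOn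
            (szSector (Λ := FermionTorus 2 L) (2 * ⌊(1 - δ) * (L : ℝ) ^ 2 / 2⌋₊) 0) := by
  rintro ⟨a, b, κ₁, κ₂, c₀, s₀, g, Δ, ha, hab, hb, hκ₁, hκ₁₂, hc₀, hs₀, hg, hpin, hS⟩
  refine false_without_interaction ⟨a, b, κ₁, κ₂, c₀, s₀, Δ, ha, hab, hb, hκ₁, hκ₁₂, hc₀, hs₀, hpin,
    fun s hs => ?_⟩
  obtain ⟨U₁, hU₁, hwin⟩ := hS s hs
  refine ⟨U₁, hU₁, ?_⟩
  intro δ hδ U hU L _ hE hlo hhi ψ hψ1 hgs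
  have hcmp := hwin δ hδ U hU L hE hlo hhi
  obtain ⟨hψK, -, hHψ⟩ := hgs
  have hHh : (hubbardTorus 2 L 1 0).IsHermitian :=
    hubbardTorus_isHermitian (hamiltonian_isHermitian_and_commute_holds _) 1 0
  have hBh : ((pairField dWaveFormFactor L)ᴴ * pairField dWaveFormFactor L).IsHermitian :=
    (pairField_conjTranspose_mul_self_posSemidef dWaveFormFactor L).1
  have hPh := isHermitian_add_ofReal_smul hHh hBh (g / (L : ℝ) ^ 2)
  -- variational principle at the free ground state `ψ` for the perturbed free Hamiltonian
  have hvar := minEnergyOn_le_rayleigh_of_mem hPh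
    (szSector (Λ := FermionTorus 2 L) (2 * ⌊(1 - δ) * (L : ℝ) ^ 2 / 2⌋₊) 0) hψK hψ1
  rw [re_quadForm_add_real_smul, hHψ, dotProduct_smul, hψ1, smul_eq_mul, mul_one,
    Complex.ofReal_re] at hvar
  have hLpos : (0 : ℝ) < (L : ℝ) := Nat.cast_pos.mpr (Nat.pos_of_ne_zero (NeZero.ne L))
  have hL2 : (0 : ℝ) < (L : ℝ) ^ 2 := by positivity
  set P : ℝ := (star ψ ⬝ᵥ ((pairField dWaveFormFactor L)ᴴ * pairField dWaveFormFactor L) *ᵥ ψ).re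
    with hP
  have hkey : g * c₀ * Δ U ^ 2 * (L : ℝ) ^ 2 ≤ g / (L : ℝ) ^ 2 * P := by linarith
  have hkey' : g * (c₀ * Δ U ^ 2 * (L : ℝ) ^ 4) ≤ g * P := by
    have h2 := mul_le_mul_of_nonneg_right hkey hL2.le
    have hid : g / (L : ℝ) ^ 2 * P * (L : ℝ) ^ 2 = g * P := by field_simp
    rw [hid] at h2
    calc g * (c₀ * Δ U ^ 2 * (L : ℝ) ^ 4) = g * c₀ * Δ U ^ 2 * (L : ℝ) ^ 2 * (L : ℝ) ^ 2 := by ring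
      _ ≤ _ := h2
  rw [le_div_iff₀ (by positivity)]
  simpa only [expect] using le_of_mul_le_mul_left hkey' hg

end Summit.HubbardSuperconductivity.HubbardSuperconductivity.Theorems.CoherenceWindowLRO.Negative
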